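import Literature.Analysis.OperatorTheory.ApproxEigenvectorHellmannFeynman
import Literature.Analysis.InnerProduct.CourantFischerBounds

/-!
# Expectation values from a certified approximate top eigenvector — the two bounds cert-1's
# eigenvector certificate actually prints (first order `2‖A‖·sin θ`, second order
# `2 sin θ·‖r_A‖ + 2 sin²θ·‖A‖`)

HONEST FRAMING: finite-dimensional / Hilbert-space linear algebra only. This file types the
expectation-value step of the certification seat's eigenvector certificate
(`flow/cert-1/code/vec/certify_vec.py` v1.1, README §1e) behind the «A-sntm(HF)+cert-1»
Hellmann–Feynman plaquette rows (object `W_S`): nothing here is a lattice, continuum,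
infinite-volume or mass-gap statement, and no class/verdict word is implied.

Setting: a real inner product space `E`, a bounded symmetric `A : E →L[ℝ] E` (the exported
observable: `D = diag(Σ dln a_j/dβ)` or the modified build `M_D`), the exact unit top eigenvector `ψ`
of the transfer-matrix block and the certified unit trial vector `v` (the `2⁴⁶`-rounded float top
vector). The certificate holds a bound `δ` on the SINE of the angle, i.e. on `‖v - ⟪ψ,v⟫ψ‖`
(Davis–Kahan, in the tree as `Literature.Analysis.OperatorTheory.norm_sub_inner_smul_le_residual_div_gap`),
the computable value `X = ⟪v, A v⟫`, the computable residual `r_A = A v - X·v` and an upper bound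
on `‖A‖`. The tree's `abs_inner_sub_inner_le_of_orth_component` gives `|X - ⟪ψ,Aψ⟫| ≤ 2‖A‖(δ + δ²)`
for ANY bounded `A`; for SYMMETRIC `A` the certificate uses the two sharper bounds proved here:

* `norm_sub_inner_smul_comm` — for unit vectors the sine is symmetric:
  `‖ψ - ⟪v,ψ⟫v‖ = ‖v - ⟪ψ,v⟫ψ‖` (both squares equal `1 - ⟪ψ,v⟫²`);
* `abs_inner_sub_inner_le_two_mul_norm_mul` — FIRST ORDER: `|⟪ψ,Aψ⟫ - ⟪v,Av⟫| ≤ 2‖A‖δ`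
  (`⟪v,Av⟫ - ⟪ψ,Aψ⟫ = ⟪v - ψ, A(v + ψ)⟫` and `‖v - ψ‖·‖v + ψ‖ = 2‖v - ⟪ψ,v⟫ψ‖`);
* `abs_inner_sub_inner_le_residual_second_order` — SECOND ORDER:
  `|⟪ψ,Aψ⟫ - ⟪v,Av⟫| ≤ 2δ‖A v - ⟪v,Av⟫v‖ + 2δ²‖A‖` (write `ψ = c v + w`, `w ⊥ v`, `c² = 1 - ‖w‖²`:
  the difference is `-‖w‖²⟪v,Av⟫ + 2c⟪w, r_A⟫ + ⟪w, A w⟫` because `⟪w, A v⟫ = ⟪w, r_A⟫`);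
* `abs_inner_sub_hellmannFeynman_le_first_order` / `…_second_order` — the same with
  `δ = ρ/(m - b)` discharged by the tree's Davis–Kahan bound from a residual `‖T v - m v‖ ≤ ρ` and a
  certified gap `⟪w, T w⟫ ≤ b‖w‖²` on `ψ^⊥`, `b < m`;
* `hellmannFeynman_mem_Icc_of_certificate` — the printed enclosure
  `⟪ψ, A ψ⟫ ∈ [X - e, X + e]`, `e = min (2Ωδ) (2δ R + 2δ²Ω)` for any `Ω ≥ ‖A‖`, `R ≥ ‖r_A‖`;
* §2 (finite dimension) `inner_apply_le_of_orthogonal_top` / `hellmannFeynman_top_mem_Icc_of_certificate`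
  — the gap hypothesis DISCHARGED from a certified `λ↓₁ ≤ b` for the top vector of Mathlib's antitone
  eigenbasis, so every hypothesis is in the certificate's own currency.

References: Y. Saad, *Numerical Methods for Large Eigenvalue Problems* (1992), Ch. III Thm. 3.9;
C. Davis–W. M. Kahan, SIAM J. Numer. Anal. 7 (1970) §2; B. N. Parlett, *The Symmetric Eigenvalue
Problem* (1998) §11.7 (quadratic accuracy of Rayleigh quotients — the `A = T` case of the second bound).
-/

noncomputable section

open scoped RealInnerProductSpace

namespace Summit.Ventures.YMGap.FlowData

namespace ExpectationCertificate

open Literature.Analysis.OperatorTheory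

variable {E : Type*} [NormedAddCommGroup E] [InnerProductSpace ℝ E]

/-- For UNIT vectors the sine of the angle is symmetric: `‖ψ - ⟪v,ψ⟫ v‖ = ‖v - ⟪ψ,v⟫ ψ‖`
(both squares are `1 - ⟪ψ, v⟫²` by Pythagoras). This converts the Davis–Kahan output (component of
the trial vector `v` orthogonal to `ψ`) into the decomposition of `ψ` along `v` used below. -/
theorem norm_sub_inner_smul_comm {ψ v : E} (hψ : ‖ψ‖ = 1) (hv : ‖v‖ = 1) :
    ‖ψ - ⟪v, ψ⟫ • v‖ = ‖v - ⟪ψ, v⟫ • ψ‖ := by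
  have h1 := norm_sq_eq_inner_sq_add_norm_orth_sq hv ψ
  have h2 := norm_sq_eq_inner_sq_add_norm_orth_sq hψ v
  rw [hψ, one_pow] at h1
  rw [hv, one_pow] at h2
  have hc : ⟪v, ψ⟫ ^ 2 = ⟪ψ, v⟫ ^ 2 := by rw [real_inner_comm]
  have hsq : ‖ψ - ⟪v, ψ⟫ • v‖ ^ 2 = ‖v - ⟪ψ, v⟫ • ψ‖ ^ 2 := by linarith
  exact (pow_left_inj₀ (norm_nonneg _) (norm_nonneg _) two_ne_zero).1 hsq

/-- The computable residual `r = A v - ⟪v, A v⟫ v` of a unit vector is orthogonal to `v`. -/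
theorem inner_residual_self_eq_zero (A : E →L[ℝ] E) {v : E} (hv : ‖v‖ = 1) :
    ⟪A v - ⟪v, A v⟫ • v, v⟫ = 0 := by
  rw [inner_sub_left, real_inner_smul_left, real_inner_self_eq_norm_sq, hv, one_pow, mul_one,
    real_inner_comm, sub_self]

/-- **First-order bound (symmetric observable).** For a bounded symmetric `A` and unit vectors `ψ`,
`v` with `‖v - ⟪ψ,v⟫ψ‖ ≤ δ`: `|⟪ψ, A ψ⟫ - ⟪v, A v⟫| ≤ 2‖A‖δ` — the certificate's
`|uᵀOu - ψ₀ᵀOψ₀| = |(u - ψ₀)ᵀ O (u + ψ₀)| ≤ ‖O‖·‖u - ψ₀‖·‖u + ψ₀‖ = 2‖O‖ sin∠` (certify_vec.py (4),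
first line), valid for either orientation of `ψ`. -/
theorem abs_inner_sub_inner_le_two_mul_norm_mul (A : E →L[ℝ] E)
    (hA : ∀ x y : E, ⟪A x, y⟫ = ⟪x, A y⟫) {ψ v : E} (hψ : ‖ψ‖ = 1) (hv : ‖v‖ = 1) {δ : ℝ}
    (hδ : ‖v - ⟪ψ, v⟫ • ψ‖ ≤ δ) :
    |⟪ψ, A ψ⟫ - ⟪v, A v⟫| ≤ 2 * ‖A‖ * δ := by
  set c : ℝ := ⟪ψ, v⟫ with hc
  set w : E := v - c • ψ with hw
  have hw0 : 0 ≤ ‖w‖ := norm_nonneg _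
  have hc2 : c ^ 2 = 1 - ‖w‖ ^ 2 := by
    have h := norm_sq_eq_inner_sq_add_norm_orth_sq hψ v
    rw [hv, one_pow] at h
    linarith
  -- the polarisation identity for symmetric `A`
  have hpol : ⟪v, A v⟫ - ⟪ψ, A ψ⟫ = ⟪v - ψ, A (v + ψ)⟫ := by
    rw [map_add, inner_sub_left, inner_add_right, inner_add_right, ← hA v ψ,
      real_inner_comm ψ (A v)]
    ring
  -- norms of `v ± ψ`
  have hm : ‖v - ψ‖ ^ 2 = 2 - 2 * c := by
    rw [@norm_sub_sq_real, hv, hψ, real_inner_comm, ← hc]; ring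
  have hp : ‖v + ψ‖ ^ 2 = 2 + 2 * c := by
    rw [@norm_add_sq_real, hv, hψ, real_inner_comm, ← hc]; ring
  have hprod : (‖v - ψ‖ * ‖v + ψ‖) ^ 2 = (2 * ‖w‖) ^ 2 := by
    rw [mul_pow, hm, hp]; linear_combination (-4 : ℝ) * hc2
  have hprod' : ‖v - ψ‖ * ‖v + ψ‖ = 2 * ‖w‖ :=
    (pow_left_inj₀ (by positivity) (by positivity) two_ne_zero).1 hprod
  have hA0 : 0 ≤ ‖A‖ := norm_nonneg _
  rw [abs_sub_comm, hpol]
  calc |⟪v - ψ, A (v + ψ)⟫| ≤ ‖v - ψ‖ * ‖A (v + ψ)‖ := abs_real_inner_le_norm _ _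
    _ ≤ ‖v - ψ‖ * (‖A‖ * ‖v + ψ‖) := by gcongr; exact A.le_opNorm _
    _ = ‖A‖ * (‖v - ψ‖ * ‖v + ψ‖) := by ring
    _ = ‖A‖ * (2 * ‖w‖) := by rw [hprod']
    _ ≤ ‖A‖ * (2 * δ) := by gcongr
    _ = 2 * ‖A‖ * δ := by ring

/-- **Second-order bound with the observable's residual (symmetric observable).** For a bounded
symmetric `A` and unit vectors `ψ`, `v` with `‖v - ⟪ψ,v⟫ψ‖ ≤ δ`:
`|⟪ψ, A ψ⟫ - ⟪v, A v⟫| ≤ 2δ·‖A v - ⟪v,Av⟫ v‖ + 2δ²·‖A‖`.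
Proof: `ψ = c v + w` with `w ⊥ v`, `‖w‖ = ‖v - ⟪ψ,v⟫ψ‖ ≤ δ`, `c² = 1 - ‖w‖²`; then
`⟪ψ,Aψ⟫ - ⟪v,Av⟫ = -‖w‖²⟪v,Av⟫ + 2c⟪w, A v - ⟪v,Av⟫v⟫ + ⟪w, A w⟫` since `⟪w, v⟫ = 0`, and
`|⟪v,Av⟫| ≤ ‖A‖`, `|c| ≤ 1`. This is certify_vec.py v1.1's line
`|ψ₀ᵀOψ₀ - uᵀOu| ≤ 2 S ‖r_O‖ + 2 S² Ω`, which is what makes the plaquette widths second order in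
the angle. -/
theorem abs_inner_sub_inner_le_residual_second_order (A : E →L[ℝ] E)
    (hA : ∀ x y : E, ⟪A x, y⟫ = ⟪x, A y⟫) {ψ v : E} (hψ : ‖ψ‖ = 1) (hv : ‖v‖ = 1) {δ : ℝ}
    (hδ : ‖v - ⟪ψ, v⟫ • ψ‖ ≤ δ) :
    |⟪ψ, A ψ⟫ - ⟪v, A v⟫| ≤ 2 * δ * ‖A v - ⟪v, A v⟫ • v‖ + 2 * δ ^ 2 * ‖A‖ := by
  -- decompose ψ along v
  set c : ℝ := ⟪v, ψ⟫ with hc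
  set w : E := ψ - c • v with hw
  set θ : ℝ := ⟪v, A v⟫ with hθ
  set r : E := A v - θ • v with hr
  have hw0 : 0 ≤ ‖w‖ := norm_nonneg _
  have hwδ : ‖w‖ ≤ δ := by rw [hw, hc, norm_sub_inner_smul_comm hψ hv]; exact hδ
  have hδ0 : 0 ≤ δ := hw0.trans hwδ
  have hc2 : c ^ 2 = 1 - ‖w‖ ^ 2 := by
    have h := norm_sq_eq_inner_sq_add_norm_orth_sq hv ψ
    rw [hψ, one_pow] at h
    linarith
  have hcabs : |c| ≤ 1 := by
    have : c ^ 2 ≤ 1 := by nlinarith [sq_nonneg ‖w‖]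
    exact abs_le_one_iff_mul_self_le_one.mpr (by nlinarith [this])
  have hwv : ⟪w, v⟫ = 0 := inner_sub_inner_smul_eq_zero hv ψ
  have hψ' : ψ = c • v + w := by rw [hw, add_sub_cancel]
  -- ⟪w, A v⟫ = ⟪w, r⟫
  have hwAv : ⟪w, A v⟫ = ⟪w, r⟫ := by
    rw [hr, inner_sub_right, real_inner_smul_right, hwv, mul_zero, sub_zero]
  have hvAw : ⟪v, A w⟫ = ⟪w, r⟫ := by rw [← hA, real_inner_comm, hwAv]
  -- expansion
  have hexp : ⟪ψ, A ψ⟫ - θ = -(‖w‖ ^ 2) * θ + 2 * c * ⟪w, r⟫ + ⟪w, A w⟫ := by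
    rw [hψ', map_add, map_smul, inner_add_left, inner_add_right, inner_add_right,
      real_inner_smul_left, real_inner_smul_left, real_inner_smul_right, real_inner_smul_right,
      hvAw, hwAv, ← hθ]
    have : c * (c * θ) = (1 - ‖w‖ ^ 2) * θ := by rw [← hc2]; ring
    rw [this]; ring
  have b1 : |θ| ≤ ‖A‖ := by
    calc |θ| ≤ ‖v‖ * ‖A v‖ := abs_real_inner_le_norm _ _
      _ ≤ ‖v‖ * (‖A‖ * ‖v‖) := by gcongr; exact A.le_opNorm v
      _ = ‖A‖ := by rw [hv, one_mul, mul_one]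
  have b2 : |⟪w, r⟫| ≤ ‖w‖ * ‖r‖ := abs_real_inner_le_norm _ _
  have b4 : |⟪w, A w⟫| ≤ ‖A‖ * ‖w‖ ^ 2 := by
    calc |⟪w, A w⟫| ≤ ‖w‖ * ‖A w‖ := abs_real_inner_le_norm _ _
      _ ≤ ‖w‖ * (‖A‖ * ‖w‖) := by gcongr; exact A.le_opNorm w
      _ = ‖A‖ * ‖w‖ ^ 2 := by ring
  have hA0 : 0 ≤ ‖A‖ := norm_nonneg _
  have hr0 : 0 ≤ ‖r‖ := norm_nonneg _
  rw [hexp]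
  calc |-(‖w‖ ^ 2) * θ + 2 * c * ⟪w, r⟫ + ⟪w, A w⟫|
      ≤ |-(‖w‖ ^ 2) * θ| + |2 * c * ⟪w, r⟫| + |⟪w, A w⟫| := by
        refine (abs_add_le _ _).trans ?_
        gcongr
        exact abs_add_le _ _
    _ ≤ ‖w‖ ^ 2 * ‖A‖ + 2 * (‖w‖ * ‖r‖) + ‖A‖ * ‖w‖ ^ 2 := by
        gcongr
        · rw [abs_mul, abs_neg, abs_of_nonneg (sq_nonneg _)]
          exact mul_le_mul_of_nonneg_left b1 (sq_nonneg _)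
        · rw [abs_mul, abs_mul, abs_two]
          calc 2 * |c| * |⟪w, r⟫| ≤ 2 * 1 * (‖w‖ * ‖r‖) := by
                gcongr
            _ = 2 * (‖w‖ * ‖r‖) := by ring
    _ = 2 * ‖w‖ * ‖r‖ + 2 * ‖w‖ ^ 2 * ‖A‖ := by ring
    _ ≤ 2 * δ * ‖r‖ + 2 * δ ^ 2 * ‖A‖ := by
        gcongr

/-- **First-order Hellmann–Feynman enclosure from a residual and a gap.** `T` symmetric bounded with
unit eigenvector `ψ` (`T ψ = Λ ψ`), Rayleigh quotient `≤ b` on `ψ^⊥`, a unit `v` with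
`‖T v - m v‖ ≤ ρ`, `b < m`; then for every bounded SYMMETRIC `A`:
`|⟪ψ, A ψ⟫ - ⟪v, A v⟫| ≤ 2‖A‖·ρ/(m - b)`. [cite: Saad1992, Ch. III Thm. 3.9 (3.24)] -/
theorem abs_inner_sub_hellmannFeynman_le_first_order (T A : E →L[ℝ] E)
    (hT : ∀ x y : E, ⟪T x, y⟫ = ⟪x, T y⟫) (hA : ∀ x y : E, ⟪A x, y⟫ = ⟪x, A y⟫)
    {ψ : E} (hψ : ‖ψ‖ = 1) {Λ : ℝ} (heig : T ψ = Λ • ψ)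
    {b m ρ : ℝ} (hbm : b < m) (hgap : ∀ w : E, ⟪w, ψ⟫ = 0 → ⟪w, T w⟫ ≤ b * ‖w‖ ^ 2)
    {v : E} (hv : ‖v‖ = 1) (hres : ‖T v - m • v‖ ≤ ρ) :
    |⟪ψ, A ψ⟫ - ⟪v, A v⟫| ≤ 2 * ‖A‖ * (ρ / (m - b)) :=
  abs_inner_sub_inner_le_two_mul_norm_mul A hA hψ hv
    (norm_sub_inner_smul_le_residual_div_gap T hT hψ heig hbm hgap hres)

/-- **Second-order Hellmann–Feynman enclosure from a residual and a gap.** Same hypotheses; then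
`|⟪ψ, A ψ⟫ - ⟪v, A v⟫| ≤ 2δ‖A v - ⟪v,Av⟫v‖ + 2δ²‖A‖` with `δ = ρ/(m - b)`.
[cite: Saad1992, Ch. III Thm. 3.9 (3.24)] -/
theorem abs_inner_sub_hellmannFeynman_le_second_order (T A : E →L[ℝ] E)
    (hT : ∀ x y : E, ⟪T x, y⟫ = ⟪x, T y⟫) (hA : ∀ x y : E, ⟪A x, y⟫ = ⟪x, A y⟫)
    {ψ : E} (hψ : ‖ψ‖ = 1) {Λ : ℝ} (heig : T ψ = Λ • ψ)
    {b m ρ : ℝ} (hbm : b < m) (hgap : ∀ w : E, ⟪w, ψ⟫ = 0 → ⟪w, T w⟫ ≤ b * ‖w‖ ^ 2)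
    {v : E} (hv : ‖v‖ = 1) (hres : ‖T v - m • v‖ ≤ ρ) :
    |⟪ψ, A ψ⟫ - ⟪v, A v⟫| ≤
      2 * (ρ / (m - b)) * ‖A v - ⟪v, A v⟫ • v‖ + 2 * (ρ / (m - b)) ^ 2 * ‖A‖ :=
  abs_inner_sub_inner_le_residual_second_order A hA hψ hv
    (norm_sub_inner_smul_le_residual_div_gap T hT hψ heig hbm hgap hres)

/-- **The printed enclosure.** With a certified sine bound `δ`, any upper bounds `Ω ≥ ‖A‖` and
`R ≥ ‖A v - ⟪v,Av⟫v‖` (the certificate's outward-rounded `Omega` and `residual_O`), and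
`e := min (2Ωδ) (2δR + 2δ²Ω)`, the exact expectation value lies in `[⟪v,Av⟫ - e, ⟪v,Av⟫ + e]`
— certify_vec.py's `lo`/`hi` before outward decimal rounding. -/
theorem hellmannFeynman_mem_Icc_of_certificate (A : E →L[ℝ] E)
    (hA : ∀ x y : E, ⟪A x, y⟫ = ⟪x, A y⟫) {ψ v : E} (hψ : ‖ψ‖ = 1) (hv : ‖v‖ = 1) {δ Ω R : ℝ}
    (hδ : ‖v - ⟪ψ, v⟫ • ψ‖ ≤ δ) (hΩ : ‖A‖ ≤ Ω) (hR : ‖A v - ⟪v, A v⟫ • v‖ ≤ R) :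
    ⟪ψ, A ψ⟫ ∈ Set.Icc (⟪v, A v⟫ - min (2 * Ω * δ) (2 * δ * R + 2 * δ ^ 2 * Ω))
      (⟪v, A v⟫ + min (2 * Ω * δ) (2 * δ * R + 2 * δ ^ 2 * Ω)) := by
  have hδ0 : 0 ≤ δ := (norm_nonneg _).trans hδ
  have h1 := abs_inner_sub_inner_le_two_mul_norm_mul A hA hψ hv hδ
  have h2 := abs_inner_sub_inner_le_residual_second_order A hA hψ hv hδ
  have h1' : |⟪ψ, A ψ⟫ - ⟪v, A v⟫| ≤ 2 * Ω * δ :=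
    h1.trans (by gcongr)
  have h2' : |⟪ψ, A ψ⟫ - ⟪v, A v⟫| ≤ 2 * δ * R + 2 * δ ^ 2 * Ω :=
    h2.trans (by gcongr)
  have h := le_min h1' h2'
  rw [abs_le] at h
  constructor <;> linarith [h.1, h.2]


/-! ### §2 Finite dimension: the gap hypothesis DISCHARGED from a certified bound on the second eigenvalue

In the certificate the gap input is not an abstract `b` but a certified upper bound `hi₁ ≥ λ↓₁` of
the SECOND largest eigenvalue of the block (step (U) of `certify.py`), and `ψ₀` is the top vector of
the antitone eigenbasis. On a finite-dimensional real inner product space (`Module.finrank ℝ E = n`,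
`1 < n`) with Mathlib's antitone enumeration `hT.eigenvalues hn` / `hT.eigenvectorBasis hn` of a
symmetric `T : E →ₗ[ℝ] E`, Courant–Fischer (tree: `Literature.Analysis.InnerProduct.
re_inner_apply_self_le_of_inner_eq_zero`) turns `λ↓₁ ≤ b` into `⟪w, T w⟫ ≤ b‖w‖²` on `ψ₀^⊥`, so the
whole chain has hypotheses in the certificate's own currency: residual `ρ`, shift `m`, `hi₁ = b < m`,
`Ω ≥ ‖A‖`, `R ≥ ‖A v - ⟪v,Av⟫v‖`. -/

section Finite

open Literature.Analysis.InnerProduct Module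

variable [FiniteDimensional ℝ E] {n : ℕ}

/-- **Gap discharge.** For symmetric `T` with antitone eigenvalues `λ↓₀ ≥ λ↓₁ ≥ …` and top eigenbasis
vector `ψ₀`, every `w ⊥ ψ₀` has `⟪w, T w⟫ ≤ λ↓₁‖w‖² ≤ b‖w‖²` whenever `λ↓₁ ≤ b`.
[cite: HornJohnson2013, Thm 4.2.6] -/
theorem inner_apply_le_of_orthogonal_top (hn : finrank ℝ E = n) (h1 : 1 < n) {T : E →ₗ[ℝ] E}
    (hT : T.IsSymmetric) {b : ℝ} (hb : hT.eigenvalues hn ⟨1, h1⟩ ≤ b) {w : E}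
    (hw : ⟪w, hT.eigenvectorBasis hn ⟨0, by omega⟩⟫ = 0) :
    ⟪w, T w⟫ ≤ b * ‖w‖ ^ 2 := by
  have h := re_inner_apply_self_le_of_inner_eq_zero hT hn ⟨1, h1⟩ (x := w) (fun i hi => by
    have hi0 : i = ⟨0, by omega⟩ := by
      apply Fin.ext; have := Fin.lt_def.mp hi; simp at this ⊢; omega
    rw [hi0, real_inner_comm]; exact hw)
  rw [RCLike.re_to_real, real_inner_comm] at h
  exact h.trans (mul_le_mul_of_nonneg_right hb (sq_nonneg _))

/-- **The expectation-value certificate with every hypothesis in the certificate's currency (finite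
dimension).** `T : E →ₗ[ℝ] E` symmetric (the block), `ψ₀ := hT.eigenvectorBasis hn 0` its top
eigenvector, `A` a bounded symmetric observable; inputs: a unit trial vector `v` with residual
`‖T v - m v‖ ≤ ρ`, a certified bound `λ↓₁ ≤ b` with `b < m`, and certified `Ω ≥ ‖A‖`,
`R ≥ ‖A v - ⟪v,Av⟫ v‖`. Then `⟪ψ₀, A ψ₀⟫ ∈ [X - e, X + e]` with `X = ⟪v, A v⟫`,
`e = min (2Ωδ) (2δR + 2δ²Ω)`, `δ = ρ/(m - b)` — certify_vec.py's enclosure, composed from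
`inner_apply_le_of_orthogonal_top`, the tree's Davis–Kahan bound and §1. -/
theorem hellmannFeynman_top_mem_Icc_of_certificate (hn : finrank ℝ E = n) (h1 : 1 < n)
    {T : E →ₗ[ℝ] E} (hT : T.IsSymmetric) (A : E →L[ℝ] E) (hA : ∀ x y : E, ⟪A x, y⟫ = ⟪x, A y⟫)
    {b m ρ : ℝ} (hb : hT.eigenvalues hn ⟨1, h1⟩ ≤ b) (hbm : b < m)
    {v : E} (hv : ‖v‖ = 1) (hres : ‖T v - m • v‖ ≤ ρ) {Ω R : ℝ} (hΩ : ‖A‖ ≤ Ω)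
    (hR : ‖A v - ⟪v, A v⟫ • v‖ ≤ R) :
    ⟪hT.eigenvectorBasis hn ⟨0, by omega⟩, A (hT.eigenvectorBasis hn ⟨0, by omega⟩)⟫ ∈
      Set.Icc (⟪v, A v⟫ - min (2 * Ω * (ρ / (m - b))) (2 * (ρ / (m - b)) * R + 2 * (ρ / (m - b)) ^ 2 * Ω))
        (⟪v, A v⟫ + min (2 * Ω * (ρ / (m - b))) (2 * (ρ / (m - b)) * R + 2 * (ρ / (m - b)) ^ 2 * Ω)) := by
  set ψ : E := hT.eigenvectorBasis hn ⟨0, by omega⟩ with hψdef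
  have hψ : ‖ψ‖ = 1 := (hT.eigenvectorBasis hn).orthonormal.1 _
  -- the continuous version of `T` and its symmetry / eigen-equation
  set Tc : E →L[ℝ] E := LinearMap.toContinuousLinearMap T with hTc
  have hTc_apply : ∀ x, Tc x = T x := fun x => rfl
  have hTsym : ∀ x y : E, ⟪Tc x, y⟫ = ⟪x, Tc y⟫ := fun x y => by rw [hTc_apply, hTc_apply]; exact hT x y
  have heig : Tc ψ = (hT.eigenvalues hn ⟨0, by omega⟩) • ψ := by
    rw [hTc_apply, hψdef, hT.apply_eigenvectorBasis]; rfl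
  have hgap : ∀ w : E, ⟪w, ψ⟫ = 0 → ⟪w, Tc w⟫ ≤ b * ‖w‖ ^ 2 := fun w hw => by
    rw [hTc_apply]; exact inner_apply_le_of_orthogonal_top hn h1 hT hb hw
  have hres' : ‖Tc v - m • v‖ ≤ ρ := by rw [hTc_apply]; exact hres
  have hδ := norm_sub_inner_smul_le_residual_div_gap Tc hTsym hψ heig hbm hgap hres'
  exact hellmannFeynman_mem_Icc_of_certificate A hA hψ hv hδ hΩ hR

end Finite

end ExpectationCertificate

end Summit.Ventures.YMGap.FlowData

end
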